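import Summits.AnomalousDissipation.AnomalousDissipation.Theses.TaylorCertificates
import Summits.AnomalousDissipation.AnomalousDissipation.Theorems.EnsembleCeiling.Negative.BeltramiFat
import Literature.Analysis.FunctionSpaces.TorusLinearisedNSEnergy
import Literature.Analysis.FunctionSpaces.TorusSobolevSpaceProofs
import HarnessLib.Audit

/-!
# Typed statements behind `STRATEGY-CENSUS.md` (crux stmt-AnomalousDissipation-13038, crux-strategist, 2026-08-16)

Props only (no proofs claimed except the trivial split glue); every constant is a tree declaration.
* §Transfer   `SteadyScalarQuietIfBounded` — the passive-scalar sibling's version of THIS step is FALSE for an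
               autonomous smooth velocity: bounded steady scalars are quiet (DiPerna–Lions renormalisation).
* §Strengthen `GalerkinUniformLoud` — the truncation-uniform strengthening, refuted by one line (`not_galerkinUniform`
               is the prose argument: at fixed `N`, `ν·enstrophy ≤ 4π²N²·ν·E → 0`); `LambRigidEverywhere` = the line's C⁺.
* §Decomposition `SteadyFloorAt`, `SteadyCeilingAt'`, `crux_of_pinned_split` (PROVED, 6 lines): the only honest split pins `f`.
* §Negation v2 (kit j018963) `Body`, `FatSteadyBranch`, `not_body_of_fatSteadyBranch` (PROVED), `F123FatSteadyBranch` (disprover target,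
               numerically TRUE: the gravest-ray branch of f₁₂₃, ν²E → 3·10⁻⁴), `FatBranchConjecture`.
* §Repair     `SteadyFloorAllBoundedSome` (floor ∀ + ceiling ∃) and `anomalousDissipation_of_floorAll_boundedSome` (PROVED, sorry-free):
               the repaired #3 still decides the summit; `energy_identity_classical`, `exists_steadyState_of_classical''`.
* §Negation   `IsPhaseOnly`, `NoRegularRayBranch` — the first-order cokernel obstruction that survives as a USABLE lemma:
               no steady branch of `NS_ν(f)` hugs `V/ν` for a phase-only (parallel-shear / single Beltrami wave) skeleton `V`
               unless `V` is the exact laminar response of the line force and the line is unfrustrated; for `f₁₂₃` all three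
               rays are frustrated, so `NoRegularRayBranch f₁₂₃` is a provable `Negative/`-grade target (recommended).
-/

noncomputable section

set_option linter.dupNamespace false

namespace Summit.AnomalousDissipation.AnomalousDissipation.Cruxes.SteadyStatesLoudBounded.StrategyCensus

open MeasureTheory Filter Topology UnitAddTorus Matrix
open scoped InnerProductSpace ENNReal
open Literature.Analysis.FunctionSpaces Literature.Analysis.FluidPDE
open Summit.AnomalousDissipation.AnomalousDissipation.Theses.TaylorCertificates

local notation "Vec3" => ((UnitAddTorus (Fin 3)) → (EuclideanSpace ℝ (Fin 3)))
local notation "𝕋³" => (UnitAddTorus (Fin 3))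

/-- The crux's steady weak form of `NS_ν(f)` at a smooth `u`. -/
def IsCruxSteady (ν : ℝ) (f u : Vec3) : Prop :=
  ∀ w : Vec3, Torus.IsSmooth w → Torus.IsDivFree w → Torus.HasZeroMean w →
    ∫ x, inner ℝ (ν • Torus.laplacian u x - Torus.convect u u x + f x) (w x) = 0

/-! ## §Transfer — the scalar sibling's step is false with an autonomous smooth velocity -/

/-- **Bounded steady scalars in a FIXED smooth incompressible velocity are quiet.** If `S_n` solve the steady
advection–diffusion equation `ν_n ΔS − V·∇S + R = 0` with `ν_n → 0` and `‖S_n‖₂` bounded, then the scalar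
dissipation `ν_n‖∇S_n‖² = (R, S_n)` tends to `0` (weak limits solve `V·∇S = R`, which renormalises for Lipschitz `V`:
`(R,S) = ∫ V·∇(S²/2) = 0`). The passive-scalar analogue of "every bounded steady state is loud" therefore needs a
velocity that roughens as `ν → 0` — in Navier–Stokes that velocity is the unknown steady state itself. [folklore:
DiPerna–Lions 1989; contrast arXiv:1911.03271, arXiv:2207.06833, arXiv:2305.05048 (time-dependent rough fields)] -/
def SteadyScalarQuietIfBounded : Prop :=
  ∀ (V : Vec3) (R : 𝕋³ → ℝ), Torus.IsSmooth V → Torus.IsDivFree V → Torus.IsSmooth R → (∫ x, R x = 0) →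
    ∀ (ν : ℕ → ℝ) (S : ℕ → 𝕋³ → ℝ), (∀ n, 0 < ν n) → Tendsto ν atTop (𝓝 0) →
      (∀ n, Torus.IsSmooth (S n) ∧ (∫ x, S n x = 0) ∧
        ∀ x, ν n * Torus.laplacian (S n) x - inner ℝ (V x) (Torus.gradient (S n) x) + R x = 0) →
      (∃ C : ℝ, ∀ n, ∫ x, (S n x) ^ 2 ≤ C) →
      Tendsto (fun n => ∫ x, R x * S n x) atTop (𝓝 0)

/-! ## §Strengthen — two S⁺ as signatures -/

/-- **S⁺₁ (FALSE): truncation-uniform loudness.** "Some admissible `f`, `ε₀, ν₀ > 0` such that for EVERY Galerkin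
truncation `N ≥ 1` and every `ν < ν₀`, every steady state of the `N`-truncated system is `ε₀`-loud" — refuted by
one line: a truncated steady state `a` (modes `|k| ≤ N`) has `ν‖∇a‖² ≤ 4π²N²·ν‖a‖²`, and `‖a‖² ≤ ‖f‖²/(16π⁴ν²)`
is no help but the CEILING is: bounded + truncated ⇒ quiet as `ν → 0` at fixed `N`. So the Galerkin lift of the
crux is false with `N`-independent `ν₀` and does not imply the crux with `ν₀(N)`: no induction on `N` exists. -/
def GalerkinUniformLoud : Prop :=
  ∃ f : Vec3, Torus.IsSmooth f ∧ Torus.IsDivFree f ∧ Torus.HasZeroMean f ∧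
    ∃ (ε₀ E ν₀ : ℝ), 0 < ε₀ ∧ 0 < ν₀ ∧ ∀ N : ℕ, 1 ≤ N → ∀ ν : ℝ, 0 < ν → ν < ν₀ →
      ∀ a : Vec3, Torus.IsSmooth a → Torus.IsDivFree a → Torus.HasZeroMean a →
        Torus.fourierTruncate N a = a →
        (∀ w : Vec3, Torus.IsSmooth w → Torus.IsDivFree w → Torus.HasZeroMean w → Torus.fourierTruncate N w = w →
          ∫ x, inner ℝ (ν • Torus.laplacian a x - Torus.convect a a x + f x) (w x) = 0) →
        ∫ x, ‖a x‖ ^ 2 ≤ E → ε₀ ≤ ν * Torus.gradNormSq a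

/-- **S⁺₂ (the registered line's C⁺): ν-free Lamb rigidity at every energy level** (plus a ceiling) implies the crux
by the landed residual transfer; it is STRONGER than the floor (it constrains approximate standing flows no viscous
branch shadows) and EASIER only in the sense that `ν` and the PDE are gone — attackable by compactness (done: landed
S3/S4) down to the single bet `NoOnsagerDodger` (open). -/
def LambRigidEverywhere (f : Vec3) : Prop :=
  ∀ E : ℝ, ∃ c δ₀ : ℝ, 0 < c ∧ 0 < δ₀ ∧
    ∀ u : Vec3, Torus.IsSmooth u → Torus.IsDivFree u → Torus.HasZeroMean u → ∫ x, ‖u x‖ ^ 2 ≤ E →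
      ∀ R : ℝ, 0 ≤ R →
        (∀ w : Vec3, Torus.IsSmooth w → Torus.IsDivFree w → Torus.HasZeroMean w →
          |∫ x, inner ℝ (Torus.convect u u x - f x) (w x)| ≤ R * Real.sqrt (Torus.gradNormSq w)) →
        R ≤ δ₀ → c ≤ R * Real.sqrt (Torus.gradNormSq u)

/-! ## §Decomposition — the only honest split pins the force -/

/-- FLOOR conjunct of the crux at a pinned `f`. -/
def SteadyFloorAt (f : Vec3) (ε₀ ν₀ : ℝ) : Prop :=
  ∀ ν : ℝ, 0 < ν → ν < ν₀ → ∀ u : Vec3, Torus.IsSmooth u → Torus.IsDivFree u → Torus.HasZeroMean u →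
    IsCruxSteady ν f u → ε₀ ≤ ν * Torus.gradNormSq u

/-- CEILING conjunct of the crux at a pinned `f`. -/
def SteadyCeilingAt' (f : Vec3) (E ν₁ : ℝ) : Prop :=
  ∀ ν : ℝ, 0 < ν → ν < ν₁ → ∀ u : Vec3, Torus.IsSmooth u → Torus.IsDivFree u → Torus.HasZeroMean u →
    IsCruxSteady ν f u → ∫ x, ‖u x‖ ^ 2 ≤ E

/-- **The pinned split closes the crux (PROVED, pure logic).** For an admissible `f`:
`SteadyFloorAt f ε₀ ν₀ → SteadyCeilingAt' f E ν₁ → SteadyStatesLoudBounded` (with `ν₀ ⊓ ν₁`). This is the shape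
`<CruxDecl>_of_subs` a route `--split` would need; NOT filed now (see the census for why: no force has yet
survived both numerical screens to ν ≈ 0.002; the registered line carries the same split without burning the
route's one decomposition). -/
theorem crux_of_pinned_split {f : Vec3} (hf : Torus.IsSmooth f ∧ Torus.IsDivFree f ∧ Torus.HasZeroMean f)
    {ε₀ ν₀ E ν₁ : ℝ} (hε₀ : 0 < ε₀) (hν₀ : 0 < ν₀) (hν₁ : 0 < ν₁)
    (hF : SteadyFloorAt f ε₀ ν₀) (hC : SteadyCeilingAt' f E ν₁) : SteadyStatesLoudBounded := by
  refine ⟨f, hf.1, hf.2.1, hf.2.2, ε₀, E, min ν₀ ν₁, hε₀, lt_min hν₀ hν₁, ?_⟩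
  intro ν hν hνlt u hus hud huz hst
  exact ⟨hF ν hν (lt_of_lt_of_le hνlt (min_le_left _ _)) u hus hud huz hst,
    hC ν hν (lt_of_lt_of_le hνlt (min_le_right _ _)) u hus hud huz hst⟩

/-! ## §Negation — the obstruction that survives as a lemma -/

/-- `V` is PHASE-ONLY along the lattice vector `k₀`: `V(x) = P(k₀·x)` for a profile on the circle, with `V ⊥ k₀`
(then `V` is automatically a smooth steady Euler flow: `(V·∇)V = (V·k₀)P' = 0`; parallel shears and single
circularly polarised Beltrami waves are the cases `dim span P = 1, 2`). -/
def IsPhaseOnly (k₀ : Fin 3 → ℤ) (V : Vec3) : Prop :=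
  ∃ P : UnitAddCircle → EuclideanSpace ℝ (Fin 3),
    (∀ x : 𝕋³, V x = P (∑ i, (k₀ i) • x i)) ∧ ∀ x : 𝕋³, ∑ i, (k₀ i : ℝ) * (V x) i = 0

/-- **No regular ray branch** of `NS_ν(f)` along the phase-only skeleton `V`: there is no sequence of steady states
`u_n` at viscosities `ν_n → 0` HUGGING `V/ν_n` in `L²` (`‖ν_n u_n − V‖₂ = o(ν_n)`, i.e. `‖u_n − V/ν_n‖₂ → 0`).
FIRST-ORDER COKERNEL OBSTRUCTION (paper proof, provable now, size M): testing the steady equation of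
`v_n = ν_n u_n` (`−ν_n²Δv + P(v·∇)v = ν_n² f`) against a smooth divergence-free PHASE-ONLY field `G(k₀·x)` kills the
linearised term exactly (`(L_V w, G) = 0`: `(V·∇)` annihilates functions of `k₀·x`, and `∫ (w·k₀) H(k₀·x) = 0` for
div-free `w`), leaves `−(w_n ⊗ w_n, ∇G) = o(ν_n²)` from the corrector `w_n = v_n − V`, and so forces
`(f + ΔV, G) = 0` for every such `G`: the LINE COMPONENT of `f` along `ℤk₀` must equal `−ΔV`, i.e. `V` is the
exact laminar response of the line force. A SECOND family of cokernel elements (fields independent of the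
polarisation direction `d₀` of a linearly polarised `V`, with zero `d₀`-component) then forces the `Π₀`-modes of
`f` off the line to vanish — the frustration test (c) of `shear-sheltering-dichotomy`. For `f₁₂₃` each of the three
rays carries a roll-forced `Π₀`-mode of another component (`(0,0,sin 6πy)` for the `e₃`-line ray, `(sin 2πz,0,0)`
for the `2e₁`-line ray, `(0,sin 4πx,0)` for the `3e₂`-line ray, pairing `1/2 ≠ 0`), and every other phase-only
skeleton (helical halves, oblique shears) already fails the first condition. Hence `NoRegularRayBranch f₁₂₃ k₀ V`
for EVERY `k₀ ≠ 0` and every nonzero phase-only `V` — exactly the class of deaths of `f_GP` (`V = h₊`, where the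
obstruction vanished by the screw symmetry of ABC: a multi-mode shell) and of Disproof §7/§9. What it does NOT
exclude: fat states with `O(1)` correctors (their Reynolds stress `(w⊗w,∇G)` enters at the same order), warm
branches, chaotic multi-mode Beltrami skeletons (absent for `f₁₂₃` by construction). -/
def NoRegularRayBranch (f : Vec3) (_k₀ : Fin 3 → ℤ) (V : Vec3) : Prop :=
  ¬ ∃ (ν : ℕ → ℝ) (u : ℕ → Vec3), (∀ n, 0 < ν n) ∧ Tendsto ν atTop (𝓝 0) ∧
      (∀ n, Torus.IsSmooth (u n) ∧ Torus.IsDivFree (u n) ∧ Torus.HasZeroMean (u n) ∧ IsCruxSteady (ν n) f (u n)) ∧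
      Tendsto (fun n => ∫ x, ‖u n x - (ν n)⁻¹ • V x‖ ^ 2) atTop (𝓝 0)

/-- The recommended `Negative/`-grade target for the ceiling chain of `f₁₂₃` (provable now by the first-order
cokernel obstruction; it certifies that the `f_GP`-type and Marchioro-type deaths cannot recur at `f₁₂₃`). -/
def F123NoRegularRayBranch : Prop :=
  ∀ (k₀ : Fin 3 → ℤ) (V : Vec3), k₀ ≠ 0 → Torus.IsSmooth V → IsPhaseOnly k₀ V → (∃ x, V x ≠ 0) →
    NoRegularRayBranch
      (∑ mm, Torus.realTrigPoly {(![![0, 0, 1], ![2, 0, 0], ![0, 3, 0]] : Fin 3 → (Fin 3 → ℤ)) mm}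
        (fun _ => (![(WithLp.toLp 2 ![-Complex.I, 0, 0] : EuclideanSpace ℂ (Fin 3)),
          (WithLp.toLp 2 ![0, -Complex.I, 0] : EuclideanSpace ℂ (Fin 3)),
          (WithLp.toLp 2 ![0, 0, -Complex.I] : EuclideanSpace ℂ (Fin 3))] : Fin 3 → EuclideanSpace ℂ (Fin 3)) mm))
      k₀ V

/-! ## §Negation v2 — FAT STEADY BRANCHES (found numerically at `f₁₂₃`, kit j018963) and what they refute -/

/-- The crux body at a pinned force (verbatim the inner block of the route decl; `crux ↔ ∃ f, admissible ∧ Body f` by `Iff.rfl`). -/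
def Body (f : Vec3) : Prop :=
  ∃ (ε₀ E ν₀ : ℝ), 0 < ε₀ ∧ 0 < ν₀ ∧ ∀ ν : ℝ, 0 < ν → ν < ν₀ → ∀ u : Vec3, Torus.IsSmooth u → Torus.IsDivFree u →
    Torus.HasZeroMean u → IsCruxSteady ν f u → ε₀ ≤ ν * Torus.gradNormSq u ∧ ∫ x, ‖u x‖ ^ 2 ≤ E

theorem crux_iff_exists_body :
    SteadyStatesLoudBounded ↔ ∃ f : Vec3, Torus.IsSmooth f ∧ Torus.IsDivFree f ∧ Torus.HasZeroMean f ∧ Body f := Iff.rfl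

/-- `f` carries a **FAT STEADY BRANCH**: smooth admissible classical steady states of unbounded energy along some `ν_n → 0⁺`.
NUMERICAL INSTANCE (kit j018963 T5, K = 6/8 Galerkin Newton, unit torus): `f = f₁₂₃`, `ν_n = 0.005 … 0.00189`,
`u_n ≈ t_n sin(2πx₃)e₁/(4π²ν_n) + w_n`, `t_n = 0.855 → 0.961`, `‖w_n‖/‖u_n‖ = 0.167 → 0.088 ≍ ν^{2/3}`, `ν_n²∫|u_n|² = 2.4 → 3.0·10⁻⁴`
(E = 9.6 → 84, local exponent → −2.1), dissipation `(f,u_n) = 2.25 → 6.53 ≍ ν⁻¹`; resolved (tail ≤ 3·10⁻⁴), K = 8 reproduces ν = 0.005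
to 0.8 %. The relaminarising Kolmogorov-shear branch of the gravest forced line, born off the primary branch at `ν ≈ 0.009`. -/
def FatSteadyBranch (f : Vec3) : Prop :=
  ∃ (ν : ℕ → ℝ) (u : ℕ → Vec3), (∀ n, 0 < ν n) ∧ Tendsto ν atTop (𝓝 0) ∧
    (∀ n, Torus.IsSmooth (u n) ∧ Torus.IsDivFree (u n) ∧ Torus.HasZeroMean (u n) ∧ IsCruxSteady (ν n) f (u n)) ∧
    Tendsto (fun n => ∫ x, ‖u n x‖ ^ 2) atTop atTop

/-- **A fat steady branch kills the crux body at that force** (PROVED: the CEILING conjunct fails along the branch). -/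
theorem not_body_of_fatSteadyBranch {f : Vec3} (h : FatSteadyBranch f) : ¬ Body f := by
  rintro ⟨ε₀, E, ν₀, _hε₀, hν₀, hB⟩
  obtain ⟨ν, u, hνpos, hν0, hadm, hE⟩ := h
  have h1 : ∀ᶠ n in atTop, ν n < ν₀ := (tendsto_order.1 hν0).2 ν₀ hν₀
  have h2 : ∀ᶠ n in atTop, E + 1 ≤ ∫ x, ‖u n x‖ ^ 2 := tendsto_atTop.1 hE (E + 1)
  obtain ⟨n, hn1, hn2⟩ := (h1.and h2).exists
  obtain ⟨hs, hd, hz, hst⟩ := hadm n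
  have := (hB (ν n) (hνpos n) hn1 (u n) hs hd hz hst).2
  linarith

/-- The disprover's typed target at the route's live candidate force (numerically true, see `FatSteadyBranch`):
with `not_body_of_fatSteadyBranch` it gives `¬ Body f₁₂₃`. A certified piece within reach: interval Newton–Kantorovich on the
K = 8 Galerkin system at three viscosities + a spectral tail bound proves three fat steady states; the asymptotic branch (`t → 1`,
corrector `≍ ν^{2/3}`) is an implicit-function problem around the Kolmogorov shear with eddy-stress closure. -/
def F123FatSteadyBranch : Prop :=
  FatSteadyBranch
    (∑ mm, Torus.realTrigPoly {(![![0, 0, 1], ![2, 0, 0], ![0, 3, 0]] : Fin 3 → (Fin 3 → ℤ)) mm}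
      (fun _ => (![(WithLp.toLp 2 ![-Complex.I, 0, 0] : EuclideanSpace ℂ (Fin 3)),
        (WithLp.toLp 2 ![0, -Complex.I, 0] : EuclideanSpace ℂ (Fin 3)),
        (WithLp.toLp 2 ![0, 0, -Complex.I] : EuclideanSpace ℂ (Fin 3))] : Fin 3 → EuclideanSpace ℂ (Fin 3)) mm))

/-- **Conjecture for the disprover (universal form of the mechanism; would refute the crux outright if it reached all smooth f).**
Every nonzero admissible trigonometric-polynomial force carries a fat steady branch. Evidence: four mechanisms now cover every
screened class — Stokes-eigen / Beltrami / `−Δ`(steady Euler) forces (exact laminar branch, Disproof §7/§9), unfrustrated generic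
finite-mode forces (sheltered fat regime, linear layers), the frustrated cyclic `f_GP` (ABC-ray half-branch, j015722), the frustrated
detuned `f₁₂₃` (gravest-ray branch with eddy-carried cross momentum, j018963). -/
def FatBranchConjecture : Prop :=
  ∀ (N : ℕ) (f : Vec3), Torus.IsSmooth f → Torus.IsDivFree f → Torus.HasZeroMean f → Torus.fourierTruncate N f = f →
    (∃ x, f x ≠ 0) → FatSteadyBranch f

/-! ## §Repair — what survives the fat branches: FLOOR for all steady states, CEILING for SOME (typed; deciding glue PROVED) -/

/-- **Repaired deciding hypothesis** (recommended to tenure / route-repair as the restatement of #3): some admissible `f` and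
`ε₀, E, ν₀ > 0` such that for every `ν ∈ (0, ν₀)` (i) EVERY smooth admissible classical steady state of `NS_ν(f)` is `ε₀`-loud and
(ii) SOME smooth admissible classical steady state has `∫|u|² ≤ E`. Fat branches do not touch it (they are loud); the primary branch of
`f₁₂₃` (E ≈ 0.57–0.65, D ≈ 0.64 for ν = 0.005–0.0022, K = 5/6/7) is the numerical candidate for (ii); (i) is the route's FLOOR thesis. -/
def SteadyFloorAllBoundedSome : Prop :=
  ∃ f : Vec3, Torus.IsSmooth f ∧ Torus.IsDivFree f ∧ Torus.HasZeroMean f ∧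
    ∃ (ε₀ E ν₀ : ℝ), 0 < ε₀ ∧ 0 < ν₀ ∧ ∀ ν : ℝ, 0 < ν → ν < ν₀ →
      (∀ u : Vec3, Torus.IsSmooth u → Torus.IsDivFree u → Torus.HasZeroMean u → IsCruxSteady ν f u →
          ε₀ ≤ ν * Torus.gradNormSq u) ∧
      (∃ u : Vec3, Torus.IsSmooth u ∧ Torus.IsDivFree u ∧ Torus.HasZeroMean u ∧ IsCruxSteady ν f u ∧ ∫ x, ‖u x‖ ^ 2 ≤ E)

/-- **Energy identity at a classical steady state**: `ν‖∇u‖² = (u, f)` (test the crux's weak form with `w = u`; Green's first identity and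
the antisymmetry of the trilinear form). -/
theorem energy_identity_classical {ν : ℝ} {f u : Vec3} (hf : Torus.IsSmooth f) (hu : Torus.IsSmooth u) (hdiv : Torus.IsDivFree u)
    (hmean : Torus.HasZeroMean u) (hst : IsCruxSteady ν f u) :
    ν * Torus.gradNormSq u = ∫ x, inner ℝ (u x) (f x) := by
  have h := hst u hu hdiv hmean
  have i1 : Integrable (fun x => inner ℝ (ν • Torus.laplacian u x) (u x)) volume := by
    have := ((hu.laplacian.inner hu).integrable).const_mul ν
    refine this.congr (ae_of_all _ fun x => ?_)
    simp [inner_smul_left]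
  have i2 : Integrable (fun x => inner ℝ (Torus.convect u u x) (u x)) volume := ((hu.convect hu).inner hu).integrable
  have i3 : Integrable (fun x => inner ℝ (f x) (u x)) volume := (hf.inner hu).integrable
  have hlap : ∫ x, inner ℝ (ν • Torus.laplacian u x) (u x) = -(ν * Torus.gradNormSq u) := by
    have : ∫ x, inner ℝ (ν • Torus.laplacian u x) (u x) = ν * ∫ x, inner ℝ (Torus.laplacian u x) (u x) := by
      rw [← integral_const_mul]
      refine integral_congr_ae (ae_of_all _ fun x => ?_)
      simp [inner_smul_left]
    rw [this, Torus.integral_inner_laplacian_self_eq_neg_gradNormSq_of_isSmooth hu]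
    ring
  have htri : ∫ x, inner ℝ (Torus.convect u u x) (u x) = 0 := by
    have h1 := Torus.integral_inner_convect_eq_neg hu hdiv hu hu
    have h2 : ∫ x, inner ℝ (u x) (Torus.convect u u x) = ∫ x, inner ℝ (Torus.convect u u x) (u x) :=
      integral_congr_ae (ae_of_all _ fun x => real_inner_comm _ _)
    rw [h2] at h1
    linarith
  have hfu : ∫ x, inner ℝ (f x) (u x) = ∫ x, inner ℝ (u x) (f x) :=
    integral_congr_ae (ae_of_all _ fun x => real_inner_comm _ _)
  have key : ∫ x, inner ℝ (ν • Torus.laplacian u x - Torus.convect u u x + f x) (u x) =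
      (∫ x, inner ℝ (ν • Torus.laplacian u x) (u x)) - (∫ x, inner ℝ (Torus.convect u u x) (u x)) + ∫ x, inner ℝ (f x) (u x) := by
    simp_rw [inner_add_left, inner_sub_left]
    rw [integral_add ?_ i3, integral_sub i1 i2]
    exact i1.sub i2
  rw [key, hlap, htri, hfu] at h
  linarith

/-- Bridge, classical ⇒ `H`-weak (same proof as the registered skeleton's `exists_steadyState_of_classical'`). -/
theorem exists_steadyState_of_classical'' {ν : ℝ} {f u : Vec3}
    (hf : Torus.IsSmooth f) (hu : Torus.IsSmooth u) (hdiv : Torus.IsDivFree u) (hmean : Torus.HasZeroMean u)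
    (hsteady : IsCruxSteady ν f u) :
    ∃ U : Torus.energySpace (Fin 3),
      ((U : Lp (EuclideanSpace ℝ (Fin 3)) 2 (volume : Measure 𝕋³)) : Vec3) =ᵐ[volume] u ∧
        (U : Lp (EuclideanSpace ℝ (Fin 3)) 2 (volume : Measure 𝕋³)) ∈ Torus.energySpaceV (Fin 3) ∧
          Torus.IsSteadyWeakSolution ν f U := by
  have hsol : (hu.memLp 2).toLp u ∈ Torus.smoothSolenoidal (Fin 3) := ⟨u, hu, hdiv, hmean, MemLp.coeFn_toLp _⟩
  refine ⟨⟨(hu.memLp 2).toLp u, Torus.smoothSolenoidal_subset_energySpace hsol⟩, (hu.memLp 2).coeFn_toLp,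
    Torus.smoothSolenoidal_subset_energySpaceV_holds hsol, fun w hw hdw hzw => ?_⟩
  have hU : ((((⟨(hu.memLp 2).toLp u, Torus.smoothSolenoidal_subset_energySpace hsol⟩ :
      Torus.energySpace (Fin 3)) : Lp (EuclideanSpace ℝ (Fin 3)) 2 (volume : Measure 𝕋³)) : Vec3)) =ᵐ[volume] u :=
    (hu.memLp 2).coeFn_toLp
  have h1 : (∫ x, inner ℝ ((((⟨(hu.memLp 2).toLp u, Torus.smoothSolenoidal_subset_energySpace hsol⟩ :
        Torus.energySpace (Fin 3)) : Lp (EuclideanSpace ℝ (Fin 3)) 2 (volume : Measure 𝕋³)) : Vec3) x) (Torus.laplacian w x)) =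
        ∫ x, inner ℝ (u x) (Torus.laplacian w x) := by
    refine integral_congr_ae ?_
    filter_upwards [hU] with x hx
    rw [hx]
  have h2 : (∫ x, inner ℝ (Torus.fderiv w x ((((⟨(hu.memLp 2).toLp u, Torus.smoothSolenoidal_subset_energySpace hsol⟩ :
        Torus.energySpace (Fin 3)) : Lp (EuclideanSpace ℝ (Fin 3)) 2 (volume : Measure 𝕋³)) : Vec3) x))
        ((((⟨(hu.memLp 2).toLp u, Torus.smoothSolenoidal_subset_energySpace hsol⟩ :
        Torus.energySpace (Fin 3)) : Lp (EuclideanSpace ℝ (Fin 3)) 2 (volume : Measure 𝕋³)) : Vec3) x)) =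
        ∫ x, inner ℝ (Torus.fderiv w x (u x)) (u x) := by
    refine integral_congr_ae ?_
    filter_upwards [hU] with x hx
    rw [hx]
  unfold Torus.nsGeneratorPairing Torus.inertialPairing
  rw [h1, h2]
  have hlap : ∫ x, inner ℝ (u x) (Torus.laplacian w x) = ∫ x, inner ℝ (Torus.laplacian u x) (w x) :=
    (Torus.integral_inner_laplacian_comm hu hw).symm
  have hconv : ∫ x, inner ℝ (Torus.fderiv w x (u x)) (u x) = -∫ x, inner ℝ (Torus.convect u u x) (w x) := by
    change ∫ x, inner ℝ (Torus.convect u w x) (u x) = _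
    rw [Torus.integral_inner_convect_eq_neg hu hdiv hw hu]
    congr 1
    exact integral_congr_ae (ae_of_all _ fun x => real_inner_comm _ _)
  have i1 : Integrable (fun x => inner ℝ (ν • Torus.laplacian u x) (w x)) volume := by
    have := ((hu.laplacian.inner hw).integrable).const_mul ν
    refine this.congr (ae_of_all _ fun x => ?_)
    simp [inner_smul_left]
  have i2 : Integrable (fun x => inner ℝ (Torus.convect u u x) (w x)) volume := ((hu.convect hu).inner hw).integrable
  have i3 : Integrable (fun x => inner ℝ (f x) (w x)) volume := (hf.inner hw).integrable
  have key : ∫ x, inner ℝ (ν • Torus.laplacian u x - Torus.convect u u x + f x) (w x) =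
      (∫ x, inner ℝ (f x) (w x)) + ν * (∫ x, inner ℝ (u x) (Torus.laplacian w x)) +
        ∫ x, inner ℝ (Torus.fderiv w x (u x)) (u x) := by
    simp_rw [inner_add_left, inner_sub_left]
    rw [integral_add ?_ i3, integral_sub i1 i2, hlap, hconv]
    · have : ∫ x, inner ℝ (ν • Torus.laplacian u x) (w x) = ν * ∫ x, inner ℝ (Torus.laplacian u x) (w x) := by
        rw [← integral_const_mul]
        refine integral_congr_ae (ae_of_all _ fun x => ?_)
        simp [inner_smul_left]
      rw [this]
      ring
    · exact i1.sub i2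
  rw [← key]
  exact hsteady w hw hdw hzw

/-- **THE REPAIRED STATEMENT DECIDES THE SUMMIT (PROVED, sorry-free): `SteadyFloorAllBoundedSome → AnomalousDissipation`.**
Same chain as the route's `closes`, with Temam's arbitrary steady state replaced by the bounded one of clause (ii): along `ν_j = ν₀/(j+2)`
take the bounded classical steady state `u_j`; it is loud by clause (i); its `H`-state `U_j ∈ V` is a steady weak solution (bridge) with
the energy equation (`energy_identity_classical`), hence the constant path is a global Leray–Hopf solution with `meanDissipation = ν‖∇u_j‖² ≥ ε₀`
and `meanEnergy = ∫|u_j|² ≤ E` (MirrorVariety's landed `steadyWeakIsGlobalLerayHopf_proof`). -/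
theorem anomalousDissipation_of_floorAll_boundedSome : SteadyFloorAllBoundedSome → _root_.AnomalousDissipation := by
  intro hS
  obtain ⟨f, hfs, hfd, hfz, ε₀, E, ν₀, hε₀, hν₀, hall⟩ := hS
  have hL := Summit.AnomalousDissipation.AnomalousDissipation.Theorems.steadyWeakIsGlobalLerayHopf_proof
  have key : ∀ j : ℕ, ∃ U : ↥(Torus.energySpace (Fin 3)),
      Torus.IsGlobalLerayHopf (ν₀ / ((j : ℝ) + 2)) (fun _ => f)
          ((U : Lp (EuclideanSpace ℝ (Fin 3)) 2 (volume : Measure 𝕋³)) : Vec3)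
          (fun _ => ((U : Lp (EuclideanSpace ℝ (Fin 3)) 2 (volume : Measure 𝕋³)) : Vec3)) ∧
        ε₀ ≤ Literature.Analysis.FluidPDE.meanDissipation (ν₀ / ((j : ℝ) + 2))
          (fun _ : ℝ => ((U : Lp (EuclideanSpace ℝ (Fin 3)) 2 (volume : Measure 𝕋³)) : Vec3)) ∧
          Literature.Analysis.FluidPDE.meanEnergy
            (fun _ : ℝ => ((U : Lp (EuclideanSpace ℝ (Fin 3)) 2 (volume : Measure 𝕋³)) : Vec3)) ≤ E := by
    intro j
    have hj : (0 : ℝ) < (j : ℝ) + 2 := by positivity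
    have hν : 0 < ν₀ / ((j : ℝ) + 2) := div_pos hν₀ hj
    have hνlt : ν₀ / ((j : ℝ) + 2) < ν₀ := by
      rw [div_lt_iff₀ hj]
      nlinarith
    obtain ⟨hfloor, u, hus, hud, huz, hust, hbdd⟩ := hall _ hν hνlt
    have hloud : ε₀ ≤ ν₀ / ((j : ℝ) + 2) * Torus.gradNormSq u := hfloor u hus hud huz hust
    obtain ⟨U, hUu, hV, hUsteady⟩ := exists_steadyState_of_classical'' hfs hus hud huz hust
    have hEq : ν₀ / ((j : ℝ) + 2) * (Torus.eGradNormSq ((U : Lp (EuclideanSpace ℝ (Fin 3)) 2 (volume : Measure 𝕋³)) : Vec3)).toReal =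
        Torus.pairing (U : Lp (EuclideanSpace ℝ (Fin 3)) 2 (volume : Measure 𝕋³)) f := by
      rw [Torus.eGradNormSq_congr_ae_field hUu, ← Torus.gradNormSq_eq_toReal_eGradNormSq_holds hus,
        energy_identity_classical hfs hus hud huz hust]
      unfold Torus.pairing
      refine integral_congr_ae ?_
      filter_upwards [hUu] with x hx
      rw [hx]
    obtain ⟨hLH, hmE, hmD⟩ := hL _ f U hν hfs hfz hV hUsteady hEq
    refine ⟨U, hLH, ?_, ?_⟩
    · rw [hmD, Torus.eGradNormSq_congr_ae_field hUu, ← Torus.gradNormSq_eq_toReal_eGradNormSq_holds hus]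
      exact hloud
    · rw [hmE]
      calc (∫ x, ‖((U : Lp (EuclideanSpace ℝ (Fin 3)) 2 (volume : Measure 𝕋³)) : Vec3) x‖ ^ 2)
            = ∫ x, ‖u x‖ ^ 2 := by
              refine integral_congr_ae ?_
              filter_upwards [hUu] with x hx
              rw [hx]
        _ ≤ E := hbdd
  choose U hU using key
  refine ⟨f, hfs, hfd, hfz, fun j => ν₀ / ((j : ℝ) + 2),
    fun j => ((U j : Lp (EuclideanSpace ℝ (Fin 3)) 2 (volume : Measure 𝕋³)) : Vec3),
    fun j _ => ((U j : Lp (EuclideanSpace ℝ (Fin 3)) 2 (volume : Measure 𝕋³)) : Vec3),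
    fun j => div_pos hν₀ (by positivity), ?_, fun j => (hU j).1, ⟨E, fun j => (hU j).2.2⟩, ε₀, hε₀, fun j => (hU j).2.1⟩
  have h1 : Tendsto (fun j : ℕ => ((j : ℝ) + 2)⁻¹) atTop (𝓝 0) :=
    tendsto_inv_atTop_zero.comp (tendsto_atTop_add_const_right atTop (2 : ℝ) tendsto_natCast_atTop_atTop)
  have h2 : Tendsto (fun j : ℕ => ν₀ * ((j : ℝ) + 2)⁻¹) atTop (𝓝 (ν₀ * 0)) := h1.const_mul ν₀
  rw [mul_zero] at h2
  simpa [div_eq_mul_inv] using h2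

/-- The repaired statement is WEAKER than the crux (every `ν > 0` has a smooth steady state — Temam — so the crux's ∀-ceiling gives
clause (ii)); stated as a Prop for the record (its proof is the first half of the route's `closes`: Temam existence + regularity + the
H-weak ⇒ classical bridge). -/
def CruxImpliesRepair : Prop := SteadyStatesLoudBounded → SteadyFloorAllBoundedSome

end Summit.AnomalousDissipation.AnomalousDissipation.Cruxes.SteadyStatesLoudBounded.StrategyCensus

end
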